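import Literature.Analysis.FluidPDE.Wei2016SwirlGradBound
import HarnessLib

/-!
# GaldiLiouvilleGateAxisymGaldiLiouvilleSwirlTailVanish — census row S3 ⟨0896⟩ `AxisymGaldiLiouville`,
# line «cylbudget» (ns-idea-4 g8), support **O3 `SwirlEnergyTailVanish`** (pure measure theory)

Seat nsreg-C26-p1 g4 (DIRECTOR-NS #204 (9) / #205 (1)(ii)); statement VERBATIM = the body of
`def SwirlEnergyTailVanish` of the line skeleton `pub/ideators/ns-idea-4/lines/cylbudget/AxisymGaldiLiouville_cylbudget_v1.lean`
(sha16 4e06f40660ee80b9, l.102; the skeleton is files-only, so the `def` is unfolded here and the theorem below IS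
its body); critic of record idea-crit-3 VERDICT 10:28:59Z (O3 = S, pure measure theory).
`--supports stmt-NavierStokesRegularity-0896 --as helper`.

**O3.** For a `C^∞` field `U : ℝ³ → ℝ³` with finite swirl energy `∫ u_θ² < ∞`, the outer-cylinder tails vanish:
`∫_{r > t} u_θ² dx → 0` as `t → ∞`.  Proof: the tails are the values of the FINITE measure `u_θ² dx` on the
decreasing family of measurable sets `{r > t}` with empty intersection (continuity from above along the countably
generated filter `atTop` on `ℝ`, `tendsto_measure_iInter_atTop`); `u_θ` is measurable for continuous `U`
(`measurable_swirlVelocity`: `u_θ = r⁻¹ Γ` with `Γ` continuous).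

WHAT THIS IS NOT: a measure-theoretic support of the RUNG `FiniteSwirlEnergyLiouville` (O1 + O2 + O3) of line
cylbudget; neither ⟨0896⟩ `AxisymGaldiLiouville`, nor census row S3, nor Navier–Stokes regularity is proved here.
[folklore]
-/

noncomputable section

open MeasureTheory Set Filter Topology
open scoped ENNReal
open Literature.Analysis.FluidPDE

set_option linter.dupNamespace false

namespace Summit.NavierStokesRegularity.NavierStokesRegularity.Theorems.AxisymGaldiLiouville.CylinderBudget

/-- **O3 `SwirlEnergyTailVanish`** (line cylbudget, VERBATIM body of the skeleton's `def`): the outer-cylinder tails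
of the finite integral `∫ u_θ²` vanish — continuity from above of the finite measure `u_θ² dx` on the decreasing
measurable sets `{x | t < r(x)}`, whose intersection over `t ∈ ℝ` is empty. [folklore] -/
theorem swirlEnergyTailVanish :
    ∀ (U : EuclideanSpace ℝ (Fin 3) → EuclideanSpace ℝ (Fin 3)), ContDiff ℝ (⊤ : ℕ∞) U →
      (∫⁻ x, ENNReal.ofReal (swirlVelocity U x ^ 2)) < ⊤ →
      Tendsto (fun t : ℝ => ∫⁻ x in {x : EuclideanSpace ℝ (Fin 3) | t < cylRadius x},
        ENNReal.ofReal (swirlVelocity U x ^ 2)) atTop (𝓝 0) := by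
  intro U hU hfin
  set f : EuclideanSpace ℝ (Fin 3) → ℝ≥0∞ := fun x => ENNReal.ofReal (swirlVelocity U x ^ 2) with hf_def
  have hf : Measurable f :=
    ENNReal.measurable_ofReal.comp ((Wei2016.measurable_swirlVelocity hU.continuous).pow_const 2)
  set ν : Measure (EuclideanSpace ℝ (Fin 3)) := volume.withDensity f with hν
  have hS : ∀ t : ℝ, MeasurableSet {x : EuclideanSpace ℝ (Fin 3) | t < cylRadius x} := fun t =>
    measurableSet_lt measurable_const continuous_cylRadius.measurable
  have heq : ∀ t : ℝ, ∫⁻ x in {x : EuclideanSpace ℝ (Fin 3) | t < cylRadius x}, f x =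
      ν {x : EuclideanSpace ℝ (Fin 3) | t < cylRadius x} := fun t => (withDensity_apply f (hS t)).symm
  have hanti : Antitone fun t : ℝ => {x : EuclideanSpace ℝ (Fin 3) | t < cylRadius x} :=
    fun s t hst x (hx : t < cylRadius x) => lt_of_le_of_lt hst hx
  have hinter : (⋂ t : ℝ, {x : EuclideanSpace ℝ (Fin 3) | t < cylRadius x}) = ∅ := by
    ext x
    simp only [mem_iInter, mem_setOf_eq, mem_empty_iff_false, iff_false, not_forall, not_lt]
    exact ⟨cylRadius x, le_rfl⟩
  have hfin' : ∃ t : ℝ, ν {x : EuclideanSpace ℝ (Fin 3) | t < cylRadius x} ≠ ⊤ :=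
    ⟨0, by
      rw [← heq]
      exact ne_top_of_le_ne_top hfin.ne (setLIntegral_le_lintegral _ _)⟩
  have h := tendsto_measure_iInter_atTop (μ := ν) (fun t => (hS t).nullMeasurableSet) hanti hfin'
  rw [hinter, measure_empty] at h
  refine h.congr fun t => ?_
  simp only [Function.comp_apply]
  exact (heq t).symm

end Summit.NavierStokesRegularity.NavierStokesRegularity.Theorems.AxisymGaldiLiouville.CylinderBudget

end
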